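import Summits.ValiantsHypothesis.ValiantsHypothesis.Theorems.KPlusLogSqLawTropicalBSeparatedThree
import Summits.ValiantsHypothesis.ValiantsHypothesis.Theorems.KPlusLogSqLawTropicalBMatchingFlips

/-!
# Route «KPlusLogSqLaw», crux `TropicalB` (stmt-ValiantsHypothesis-19771) — ONE LEVEL, ONE STEP of the lexicographic tower of a
# separated design: the level's count and its free-vertex box move by O(the flips coming from above)

HONEST FRAMING.  Helper toward the registered stubs `stub_tropThin` / `stub_tropFat` of `Cruxes/TropicalB/Lines/birth.lean`
(crux `Summit.ValiantsHypothesis.ValiantsHypothesis.Theses.KPlusLogSqLaw.TropicalB`, item stmt-ValiantsHypothesis-19771, route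
KPlusLogSqLaw; cell `pub-symmetroid`, seat val-sym-trop-p1 g8, 2026-08-27; `--supports … --as helper`).  A SECTOR lemma (pure
lexicographic designs with a dense bottom class and ODD digits, chains at EVEN slopes — the «half-integer» normalisation under which no
level ever ties at a chain slope); nothing here bounds `TropicalB` for general designs or bears on `WeakLifting`, DoorA26 / DoorA34,
`MatrixDescartes` (stmt-ValiantsHypothesis-18050) or VP ≠ VNP.

THE STEP LEMMA (`level_step`; memo SEPARATED-LEVELS-g8.md §2, Lemmas 3–4 and the T/A recursion, for every `K`).  Classes are indexed in
increasing exponent order (`StrictMono d`, bottom `z` with `d z = 0`).  For a class `l ≠ z` and a term `p`, the level's BOX is the set of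
present class-`l` cells on the rows `Ua p l` / columns `Ub p l` not used by the classes above `l`, and `S p l` = the class-`l` cells of `p`.
For two terms `p₀`, `p₁` dominant at window slopes `θ₀ < θ₁`, `θ₁` even:
* `|S₀| ≤ |S₁| + #(rows/cols of the box lost)`;
* the FREE sets one level down, `Ua ∖ dom S` and `Ub ∖ rng S`, move (four one-sided differences) by at most
  `5·(moves of the box) + 2(|S₁| − |S₀|)`;
* if `S₀ ≠ S₁` then `|S₀| + 1 ≤ |S₁| + 2·(moves of the box)`.
Ingredients: `SeparatedLex.level_min_of_isDominant` (the cells minimise the level objective), `unique_levelMin` (odd digits + even slope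
+ generic digits ⇒ the minimiser of every box is unique), `MatchingExchange.cover_mono_of_param` (θ-step: nested growth),
`MatchingExchange.box_flips` (vertex flips: one count unit and two coverage vertices per flip).
-/

set_option linter.dupNamespace false
set_option autoImplicit false

namespace Summit.ValiantsHypothesis.ValiantsHypothesis.Theorems.KPlusLogSqLaw

namespace SeparatedLex

open Summit.ValiantsHypothesis.ValiantsHypothesis.Theorems.MatrixDescartes.Negative
open Finset
open scoped BigOperators
open Literature.Computability.MetaComplexity.PBij
open MatchingExchange

variable {m K : ℕ}

/-- **NO TIES under the half-integer normalisation.**  If all weights `f e` on `G` are ODD, `θ` is EVEN, and distinct equal-size matchings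
inside `G` have distinct `f`-sums, then `Σ_{e∈M} f e − θ·|M|` has at most one minimiser among the matchings inside `G`. -/
theorem unique_levelMin {α β : Type*} [DecidableEq α] [DecidableEq β] {G : Finset (α × β)} {f : α × β → ℤ} {θ : ℤ}
    (hodd : ∀ e ∈ G, Odd (f e)) (heven : Even θ)
    (hgen : ∀ X Y : Finset (α × β), IsPMatching X → IsPMatching Y → X ⊆ G → Y ⊆ G → X.card = Y.card →
      ∑ e ∈ X, f e = ∑ e ∈ Y, f e → X = Y)
    {M₁ M₂ : Finset (α × β)} (hM₁ : IsPMatching M₁) (hM₁G : M₁ ⊆ G) (hM₂ : IsPMatching M₂) (hM₂G : M₂ ⊆ G)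
    (hmin₁ : ∀ X : Finset (α × β), IsPMatching X → X ⊆ G → ∑ e ∈ M₁, (f e - θ) ≤ ∑ e ∈ X, (f e - θ))
    (hmin₂ : ∀ X : Finset (α × β), IsPMatching X → X ⊆ G → ∑ e ∈ M₂, (f e - θ) ≤ ∑ e ∈ X, (f e - θ)) : M₁ = M₂ := by
  -- parity: the value `Σ (f e − θ)` of a matching has the parity of its size, so all minimisers have sizes of one parity
  have hpar : ∀ X : Finset (α × β), X ⊆ G → ∃ t : ℤ, ∑ e ∈ X, (f e - θ) = 2 * t + X.card := by
    intro X hXG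
    induction X using Finset.induction_on with
    | empty => exact ⟨0, by simp⟩
    | insert a X ha ih =>
      obtain ⟨t, ht⟩ := ih (fun e he => hXG (Finset.mem_insert_of_mem he))
      obtain ⟨r, hr⟩ := hodd a (hXG (Finset.mem_insert_self _ _))
      obtain ⟨s, hs⟩ := heven
      refine ⟨t + r - s, ?_⟩
      rw [Finset.sum_insert ha, ht, Finset.card_insert_of_notMem ha, hr, hs]; push_cast; ring
  -- main: by strong induction on the size difference, via the exchange lemma
  have key : ∀ (j : ℕ) (X Y : Finset (α × β)), Y.card = X.card + j → IsPMatching X → X ⊆ G → IsPMatching Y → Y ⊆ G →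
      (∀ Z : Finset (α × β), IsPMatching Z → Z ⊆ G → ∑ e ∈ X, (f e - θ) ≤ ∑ e ∈ Z, (f e - θ)) →
      (∀ Z : Finset (α × β), IsPMatching Z → Z ⊆ G → ∑ e ∈ Y, (f e - θ) ≤ ∑ e ∈ Z, (f e - θ)) → X = Y := by
    intro j
    induction j using Nat.strong_induction_on with
    | _ j ih =>
      intro X Y hj hX hXG hY hYG hminX hminY
      rcases Nat.eq_zero_or_pos j with hj0 | hjpos
      · -- equal sizes: equal values, equal sums, hence equal by genericity
        subst hj0
        have h1 := hminX Y hY hYG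
        have h2 := hminY X hX hXG
        have hv : ∑ e ∈ X, (f e - θ) = ∑ e ∈ Y, (f e - θ) := le_antisymm h1 h2
        simp only [Finset.sum_sub_distrib, Finset.sum_const, hj, Nat.add_zero] at hv
        exact hgen X Y hX hY hXG hYG (by omega) (by linarith)
      · rcases Nat.lt_or_ge j 2 with hj2 | hj2
        · -- size difference one: parities of the (equal) values differ — impossible
          exfalso
          have hj1 : j = 1 := by omega
          subst hj1
          obtain ⟨t₁, ht₁⟩ := hpar X hXG
          obtain ⟨t₂, ht₂⟩ := hpar Y hYG
          have hv : ∑ e ∈ X, (f e - θ) = ∑ e ∈ Y, (f e - θ) := le_antisymm (hminX Y hY hYG) (hminY X hX hXG)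
          rw [ht₁, ht₂, hj] at hv
          push_cast at hv
          omega
        · -- size difference ≥ 2: exchange gives two more minimisers of sizes `|X|+1`, `|Y|−1`; the first has the wrong parity
          exfalso
          obtain ⟨N₁, N₂, hN₁, hN₂, hU, hI, hc, -, -⟩ := exchange hX hY (by omega)
          have hUG : X ∪ Y ⊆ G := Finset.union_subset hXG hYG
          have hN₁G : N₁ ⊆ G := (subset_union_left hU).trans hUG
          have hN₂G : N₂ ⊆ G := (subset_union_right hU).trans hUG
          have hsum := wt_add_eq hU hI (fun e => f e - θ)
          have h1 := hminX N₁ hN₁ hN₁G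
          have h2 := hminX N₂ hN₂ hN₂G
          have h3 := hminX Y hY hYG
          have h4 := hminY X hX hXG
          -- so `N₁` is a minimiser too, of size `|X| + 1`
          have hminN : ∀ Z : Finset (α × β), IsPMatching Z → Z ⊆ G → ∑ e ∈ N₁, (f e - θ) ≤ ∑ e ∈ Z, (f e - θ) := by
            intro Z hZ hZG; have := hminX Z hZ hZG; linarith
          have := ih 1 (by omega) X N₁ hc hX hXG hN₁ hN₁G hminX hminN
          rw [← this] at hc
          omega
  rcases le_total M₁.card M₂.card with hle | hle
  · exact key (M₂.card - M₁.card) M₁ M₂ (by omega) hM₁ hM₁G hM₂ hM₂G hmin₁ hmin₂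
  · exact (key (M₁.card - M₂.card) M₂ M₁ (by omega) hM₂ hM₂G hM₁ hM₁G hmin₂ hmin₁).symm

/-- one-sided differences of «free sets» are controlled by those of the ambient sets and of the removed sets. [folklore] -/
theorem card_sdiff_sdiff_le {γ : Type*} [DecidableEq γ] (A₀ A₁ D₀ D₁ : Finset γ) :
    ((A₀ \ D₀) \ (A₁ \ D₁)).card ≤ (A₀ \ A₁).card + (D₁ \ D₀).card := by
  calc ((A₀ \ D₀) \ (A₁ \ D₁)).card ≤ ((A₀ \ A₁) ∪ (D₁ \ D₀)).card :=
        Finset.card_le_card (fun x hx => by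
          simp only [Finset.mem_sdiff, Finset.mem_union, not_and, not_not] at hx ⊢
          by_cases h : x ∈ A₁
          · exact Or.inr ⟨hx.2 h, hx.1.2⟩
          · exact Or.inl ⟨hx.1.1, h⟩)
    _ ≤ _ := Finset.card_union_le _ _

/-- **THE LEVEL STEP** (see the module docstring).  Hypotheses: the pure lexicographic design of `SeparatedLex.level_min_of_isDominant`
with classes in increasing exponent order, ODD digits in the class `l`, generic digits in the class `l`; two terms dominant at EVEN window
slopes `θ₀ < θ₁` (`θ₁` even).  Conclusions: the three inequalities relating the class-`l` cells `S` and the free sets below them. -/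
theorem level_step (d : Fin K → ℕ) (v ε : Fin m → Fin m → Fin K → ℤ) (u : Fin m → Fin m → Fin K → ℤ)
    (A : ℕ) (z l : Fin K) (hlz : l ≠ z) (hdz : d z = 0) (hmono : StrictMono d)
    (hu : ∀ a b j, j ≠ z → v a b j = (d j : ℤ) * u a b j) (huA : ∀ a b j, |u a b j| ≤ A) (hvz : ∀ a b, |v a b z| ≤ A)
    (hdense : ∀ a b, ε a b z ≠ 0)
    (hsep : ∀ j j', d j < d j' → 8 * m ^ 2 * (A + 1) * d j ≤ d j') (hsep0 : ∀ j, j ≠ z → 8 * m ^ 2 * (A + 1) ≤ d j)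
    (hodd : ∀ a b, ε a b l ≠ 0 → Odd (u a b l))
    (hgen : ∀ X Y : Finset (Fin m × Fin m), IsPMatching X → IsPMatching Y → (∀ e ∈ X, ε e.1 e.2 l ≠ 0) →
      (∀ e ∈ Y, ε e.1 e.2 l ≠ 0) → X.card = Y.card → ∑ e ∈ X, u e.1 e.2 l = ∑ e ∈ Y, u e.1 e.2 l → X = Y)
    {θ₀ θ₁ : ℤ} (hθ : θ₀ < θ₁) (he₁ : Even θ₁)
    (hw₀ : |θ₀| ≤ (2 * m + 1) * A + 1) (hw₁ : |θ₁| ≤ (2 * m + 1) * A + 1)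
    {p₀ p₁ : Equiv.Perm (Fin m) × (Fin m → Fin K)} (hp₀ : IsDominant d v ε θ₀ p₀) (hp₁ : IsDominant d v ε θ₁ p₁) :
    let Ua₀ : Finset (Fin m) := Finset.univ \ (Finset.univ.filter fun b => l < p₀.2 b).image p₀.1
    let Ub₀ : Finset (Fin m) := Finset.univ \ (Finset.univ.filter fun b => l < p₀.2 b)
    let Ua₁ : Finset (Fin m) := Finset.univ \ (Finset.univ.filter fun b => l < p₁.2 b).image p₁.1
    let Ub₁ : Finset (Fin m) := Finset.univ \ (Finset.univ.filter fun b => l < p₁.2 b)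
    let S₀ : Finset (Fin m × Fin m) := (Finset.univ.filter fun b : Fin m => p₀.2 b = l).image fun b => (p₀.1 b, b)
    let S₁ : Finset (Fin m × Fin m) := (Finset.univ.filter fun b : Fin m => p₁.2 b = l).image fun b => (p₁.1 b, b)
    let s : ℕ := (Ua₀ \ Ua₁).card + (Ua₁ \ Ua₀).card + (Ub₀ \ Ub₁).card + (Ub₁ \ Ub₀).card
    S₀.card ≤ S₁.card + (Ua₀ \ Ua₁).card + (Ub₀ \ Ub₁).card ∧
    ((Ua₀ \ dom S₀) \ (Ua₁ \ dom S₁)).card + ((Ua₁ \ dom S₁) \ (Ua₀ \ dom S₀)).card +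
      ((Ub₀ \ rng S₀) \ (Ub₁ \ rng S₁)).card + ((Ub₁ \ rng S₁) \ (Ub₀ \ rng S₀)).card + 2 * S₀.card ≤ 5 * s + 2 * S₁.card ∧
    (S₀ ≠ S₁ → S₀.card + 1 ≤ S₁.card + 2 * s) := by
  intro Ua₀ Ub₀ Ua₁ Ub₁ S₀ S₁ s
  classical
  have hinj : Function.Injective d := hmono.injective
  -- the class-`l` cells and their boxes
  set El : Finset (Fin m × Fin m) := Finset.univ.filter fun e => ε e.1 e.2 l ≠ 0 with hEl
  have hmemEl : ∀ e, e ∈ El ↔ ε e.1 e.2 l ≠ 0 := fun e => by simp [hEl]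
  have hS₀m : IsPMatching S₀ := isPMatching_cells p₀ l
  have hS₁m : IsPMatching S₁ := isPMatching_cells p₁ l
  -- generic / odd digits on every box of `El`
  have hgenB : ∀ (G : Finset (Fin m × Fin m)), G ⊆ El → ∀ X Y : Finset (Fin m × Fin m), IsPMatching X → IsPMatching Y →
      X ⊆ G → Y ⊆ G → X.card = Y.card →
      ∑ e ∈ X, (fun e : Fin m × Fin m => u e.1 e.2 l) e = ∑ e ∈ Y, (fun e : Fin m × Fin m => u e.1 e.2 l) e → X = Y := by
    intro G hG X Y hX hY hXG hYG hc hs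
    exact hgen X Y hX hY (fun e he => (hmemEl e).1 (hG (hXG he))) (fun e he => (hmemEl e).1 (hG (hYG he))) hc hs
  -- uniqueness of the level minimiser on EVERY box, at the even slope θ₁ (weight `u − θ₁`)
  have hUq : ∀ (Ua : Finset (Fin m)) (Ub : Finset (Fin m)) (M₁ M₂ : Finset (Fin m × Fin m)),
      IsPMatching M₁ → M₁ ⊆ El.filter (fun e => e.1 ∈ Ua ∧ e.2 ∈ Ub) →
      (∀ X : Finset (Fin m × Fin m), IsPMatching X → X ⊆ El.filter (fun e => e.1 ∈ Ua ∧ e.2 ∈ Ub) →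
        ∑ e ∈ M₁, (u e.1 e.2 l - θ₁) ≤ ∑ e ∈ X, (u e.1 e.2 l - θ₁)) →
      IsPMatching M₂ → M₂ ⊆ El.filter (fun e => e.1 ∈ Ua ∧ e.2 ∈ Ub) →
      (∀ X : Finset (Fin m × Fin m), IsPMatching X → X ⊆ El.filter (fun e => e.1 ∈ Ua ∧ e.2 ∈ Ub) →
        ∑ e ∈ M₂, (u e.1 e.2 l - θ₁) ≤ ∑ e ∈ X, (u e.1 e.2 l - θ₁)) → M₁ = M₂ := by
    intro Ua Ub M₁ M₂ hM₁ hM₁G hmin₁ hM₂ hM₂G hmin₂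
    refine unique_levelMin (f := fun e : Fin m × Fin m => u e.1 e.2 l) (fun e he => ?_) he₁
      (hgenB _ (Finset.filter_subset _ _)) hM₁ hM₁G hM₂ hM₂G hmin₁ hmin₂
    exact hodd e.1 e.2 ((hmemEl e).1 (Finset.mem_filter.1 he).1)
  -- the cells minimise the level objective on their boxes (dominance, lexicographic exactness)
  have hbox : ∀ (p : Equiv.Perm (Fin m) × (Fin m → Fin K)) {θ : ℤ}, |θ| ≤ (2 * m + 1) * A + 1 → IsDominant d v ε θ p →
      ((Finset.univ.filter fun b : Fin m => p.2 b = l).image fun b => (p.1 b, b)) ⊆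
        El.filter (fun e => e.1 ∈ Finset.univ \ (Finset.univ.filter fun b => l < p.2 b).image p.1 ∧
          e.2 ∈ Finset.univ \ (Finset.univ.filter fun b => l < p.2 b)) ∧
      ∀ X : Finset (Fin m × Fin m), IsPMatching X →
        X ⊆ El.filter (fun e => e.1 ∈ Finset.univ \ (Finset.univ.filter fun b => l < p.2 b).image p.1 ∧
          e.2 ∈ Finset.univ \ (Finset.univ.filter fun b => l < p.2 b)) →
        ∑ e ∈ ((Finset.univ.filter fun b : Fin m => p.2 b = l).image fun b => (p.1 b, b)), u e.1 e.2 l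
            - θ * ((((Finset.univ.filter fun b : Fin m => p.2 b = l).image fun b => (p.1 b, b))).card : ℤ)
          ≤ ∑ e ∈ X, u e.1 e.2 l - θ * (X.card : ℤ) := by
    intro p θ hw hp
    have hpres := (termSign_ne_zero_iff ε p).1 hp.1
    constructor
    · intro e he
      rw [mem_cells] at he
      rw [Finset.mem_filter, hmemEl, Finset.mem_sdiff, Finset.mem_sdiff, Finset.mem_image, Finset.mem_filter]
      refine ⟨by rw [he.1, ← he.2]; exact hpres e.2, ⟨Finset.mem_univ _, ?_⟩, ⟨Finset.mem_univ _, ?_⟩⟩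
      · rintro ⟨b, hb, hbe⟩
        rw [Finset.mem_filter] at hb
        rw [he.1] at hbe
        have := p.1.injective hbe
        rw [this, he.2] at hb
        exact lt_irrefl _ hb.2
      · rw [he.2]; exact fun h => lt_irrefl _ h.2
    · intro X hX hXG
      refine level_min_of_isDominant d v ε u A z l hlz hdz hinj hu huA hvz hdense hsep hsep0 hw hp X hX
        (fun e he => (hmemEl e).1 (Finset.mem_filter.1 (hXG he)).1) (fun e he b hb => ?_) (fun e he hlt => ?_)
      · have h1 := (Finset.mem_filter.1 (hXG he)).2.1
        rw [Finset.mem_sdiff] at h1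
        intro hbe
        exact h1.2 (Finset.mem_image.2 ⟨b, Finset.mem_filter.2 ⟨Finset.mem_univ _, hmono.lt_iff_lt.1 hb⟩, hbe⟩)
      · have h1 := (Finset.mem_filter.1 (hXG he)).2.2
        rw [Finset.mem_sdiff] at h1
        exact h1.2 (Finset.mem_filter.2 ⟨Finset.mem_univ _, hmono.lt_iff_lt.1 hlt⟩)
  obtain ⟨hS₀G, hmin₀⟩ := hbox p₀ hw₀ hp₀
  obtain ⟨hS₁G, hmin₁⟩ := hbox p₁ hw₁ hp₁
  -- the intermediate optimum: minimiser at θ₁ on the box of p₀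
  obtain ⟨M, hM, hMG, hminM'⟩ := exists_isMin (El.filter (fun e => e.1 ∈ Ua₀ ∧ e.2 ∈ Ub₀)) (fun e => u e.1 e.2 l - θ₁)
  have hminM : ∀ X : Finset (Fin m × Fin m), IsPMatching X → X ⊆ El.filter (fun e => e.1 ∈ Ua₀ ∧ e.2 ∈ Ub₀) →
      ∑ e ∈ M, u e.1 e.2 l - θ₁ * (M.card : ℤ) ≤ ∑ e ∈ X, u e.1 e.2 l - θ₁ * (X.card : ℤ) := by
    intro X hX hXG; have := hminM' X hX hXG; rwa [sum_sub_const, sum_sub_const] at this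
  -- θ-step on the box of p₀: count up, coverage nested
  have hcm : S₀.card ≤ M.card :=
    card_mono_of_param (u := fun e => u e.1 e.2 l) hθ hS₀m hS₀G hM hMG hmin₀ hminM
  have hnest : dom S₀ ⊆ dom M ∧ rng S₀ ⊆ rng M :=
    cover_mono_of_param (u := fun e => u e.1 e.2 l) hθ (hgenB _ (Finset.filter_subset _ _)) hS₀m hS₀G hM hMG hmin₀ hminM
  -- flips from the box of p₀ to the box of p₁ at the fixed slope θ₁
  have hmin₁' : ∀ X : Finset (Fin m × Fin m), IsPMatching X → X ⊆ El.filter (fun e => e.1 ∈ Ua₁ ∧ e.2 ∈ Ub₁) →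
      ∑ e ∈ S₁, (u e.1 e.2 l - θ₁) ≤ ∑ e ∈ X, (u e.1 e.2 l - θ₁) := by
    intro X hX hXG; rw [sum_sub_const, sum_sub_const]; exact hmin₁ X hX hXG
  obtain ⟨f1, f2, f3⟩ := box_flips (E := El) (w := fun e => u e.1 e.2 l - θ₁) hUq s Ua₀ Ua₁ Ub₀ Ub₁ M S₁ rfl hM hMG hminM'
    hS₁m hS₁G hmin₁'
  -- coverage difference between S₀ and M: only growth
  have hd0 : (dom S₀ \ dom M).card = 0 := by rw [Finset.sdiff_eq_empty_iff_subset.2 hnest.1]; rfl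
  have hr0 : (rng S₀ \ rng M).card = 0 := by rw [Finset.sdiff_eq_empty_iff_subset.2 hnest.2]; rfl
  have hd1 : (dom M \ dom S₀).card = M.card - S₀.card := by
    rw [Finset.card_sdiff_of_subset hnest.1, hM.card_dom, hS₀m.card_dom]
  have hr1 : (rng M \ rng S₀).card = M.card - S₀.card := by
    rw [Finset.card_sdiff_of_subset hnest.2, hM.card_rng, hS₀m.card_rng]
  -- triangle inequalities through M for the coverage differences S₀ ↔ S₁
  have t1 := card_sdiff_triangle (dom S₀) (dom M) (dom S₁)
  have t2 := card_sdiff_triangle (dom S₁) (dom M) (dom S₀)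
  have t3 := card_sdiff_triangle' (rng S₀) (rng M) (rng S₁)
  have t4 := card_sdiff_triangle' (rng S₁) (rng M) (rng S₀)
  -- the free sets one level down
  have l1 := card_sdiff_sdiff_le Ua₀ Ua₁ (dom S₀) (dom S₁)
  have l2 := card_sdiff_sdiff_le Ua₁ Ua₀ (dom S₁) (dom S₀)
  have l3 := card_sdiff_sdiff_le Ub₀ Ub₁ (rng S₀) (rng S₁)
  have l4 := card_sdiff_sdiff_le Ub₁ Ub₀ (rng S₁) (rng S₀)
  refine ⟨by omega, by omega, fun hne => ?_⟩
  -- the change indicator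
  by_cases hs : s = 0
  · -- no flips: the boxes coincide, so `S₁ = M`, and a change forces a larger count
    have e1 : Ua₀ \ Ua₁ = ∅ := Finset.card_eq_zero.1 (by omega)
    have e2 : Ua₁ \ Ua₀ = ∅ := Finset.card_eq_zero.1 (by omega)
    have e3 : Ub₀ \ Ub₁ = ∅ := Finset.card_eq_zero.1 (by omega)
    have e4 : Ub₁ \ Ub₀ = ∅ := Finset.card_eq_zero.1 (by omega)
    rw [Finset.sdiff_eq_empty_iff_subset] at e1 e2 e3 e4
    have hUa : Ua₁ = Ua₀ := Finset.Subset.antisymm e2 e1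
    have hUb : Ub₁ = Ub₀ := Finset.Subset.antisymm e4 e3
    have hS₁G' : S₁ ⊆ El.filter (fun e => e.1 ∈ Ua₀ ∧ e.2 ∈ Ub₀) := by rw [← hUa, ← hUb]; exact hS₁G
    have hmin₁G : ∀ X : Finset (Fin m × Fin m), IsPMatching X → X ⊆ El.filter (fun e => e.1 ∈ Ua₀ ∧ e.2 ∈ Ub₀) →
        ∑ e ∈ S₁, (u e.1 e.2 l - θ₁) ≤ ∑ e ∈ X, (u e.1 e.2 l - θ₁) := by rw [← hUa, ← hUb]; exact hmin₁'
    have hmin₁P : ∀ X : Finset (Fin m × Fin m), IsPMatching X → X ⊆ El.filter (fun e => e.1 ∈ Ua₀ ∧ e.2 ∈ Ub₀) →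
        ∑ e ∈ S₁, u e.1 e.2 l - θ₁ * (S₁.card : ℤ) ≤ ∑ e ∈ X, u e.1 e.2 l - θ₁ * (X.card : ℤ) := by
      intro X hX hXG; have := hmin₁G X hX hXG; rwa [sum_sub_const, sum_sub_const] at this
    -- if the counts were equal, S₀ = S₁
    by_contra hlt
    have hc : S₀.card = S₁.card := by omega
    have huniq₁ : ∀ X : Finset (Fin m × Fin m), IsPMatching X → X ⊆ El.filter (fun e => e.1 ∈ Ua₀ ∧ e.2 ∈ Ub₀) →
        ∑ e ∈ X, u e.1 e.2 l - θ₁ * (X.card : ℤ) ≤ ∑ e ∈ S₁, u e.1 e.2 l - θ₁ * (S₁.card : ℤ) → X = S₁ := by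
      intro X hX hXG hle
      refine hUq Ua₀ Ub₀ X S₁ hX hXG (fun Y hY hYG => ?_) hS₁m hS₁G' hmin₁G
      rw [sum_sub_const, sum_sub_const]; exact hle.trans (hmin₁P Y hY hYG)
    exact hne (eq_of_param_of_card_eq (u := fun e => u e.1 e.2 l) hS₀m hS₀G hS₁m hS₁G' hmin₀ huniq₁ hc)
  · omega

end SeparatedLex

end Summit.ValiantsHypothesis.ValiantsHypothesis.Theorems.KPlusLogSqLaw
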